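import Mathlib
import Summits.RiemannHypothesis.RiemannHypothesis.Theorems.WeilGroundStateGroundStatesConvergeToXiStubPsiDecay
import Summits.RiemannHypothesis.RiemannHypothesis.Theorems.WeilGroundStateGroundStatesConvergeToXiStubMellinXi
import Summits.RiemannHypothesis.RiemannHypothesis.Theorems.WeilGroundStateGroundStatesConvergeToXiStubPointwiseOfWeak
import Literature.NumberTheory.LFunctions.WeilExplicit
import Literature.NumberTheory.LFunctions.WeilGroundState
import Literature.NumberTheory.LFunctions.RiemannXi

/-!
# `GroundStatesConvergeToXi`, line `Sketch` — stub `stub_pointwise_of_tight_moments`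

Crux item `stmt-RiemannHypothesis-1527` (route `WeilGroundState`), transfer architecture through
Riemann's kernel `Φ(t) = 2Ψ(2t)` (`LagariasMontague.Psic`), whose Mellin–Laplace transform
`weilMellin Φ` is `ξ` (`stub_mellinXi`).

This file proves the RH-free step **tight moments ⇒ pointwise**: if the renormalised ground
states `c_k u_k` are TIGHT in every weighted `L¹(e^{b|t|} dt)`, `b < 1/2`, and ALL THEIR MOMENTS
converge, `c_k ∫ u_k(t) tⁿ dt → ∫ Φ(t) tⁿ dt`, then `c_k û_k(σ) → ξ(σ)` for every real
`σ ∈ (0, 1)`, where `û = weilMellin u`, `û(s) = ∫ u(t) e^{(s - 1/2)t} dt`.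

Proof. Put `z = σ − 1/2`, `|z| < b := (|z| + 1/2)/2 < 1/2`, `M := M_b`.
1. *Exponential series inside the integral* (`stub_pointwise_of_tight_moments_hasSum_integral`):
   for `v` with `∫ ‖v‖ e^{b|t|} < ∞` and `‖z‖ ≤ b`,
   `∫ v(t) e^{zt} dt = Σₙ zⁿ/n! ∫ v(t) tⁿ dt`, by dominated convergence for series
   (`hasSum_integral_of_dominated_convergence`) with the summable majorant
   `‖v(t)‖ (b|t|)ⁿ/n!`, whose sum is `‖v(t)‖ e^{b|t|}`.  Applied to `v = u_k` this gives
   `c_k û_k(σ) = Σₙ zⁿ/n! · c_k ∫ u_k tⁿ`; applied to `v = Φ` (all exponential moments of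
   `Ψ(2·)` are finite, `stub_psiDecay`) and combined with `weilMellin Φ σ = ξ(σ)`
   (`stub_mellinXi`) it gives `ξ(σ) = Σₙ zⁿ/n! ∫ Φ tⁿ`.
2. *Tannery in `k`* (`tendsto_tsum_of_dominated_convergence`): termwise convergence is the
   moment hypothesis; the `k`-uniform summable majorant is geometric,
   `‖zⁿ/n! · c_k ∫ u_k tⁿ‖ ≤ (|z|/b)ⁿ ∫ ‖c_k u_k‖ e^{b|t|} ≤ M (|z|/b)ⁿ`
   (`stub_pointwise_of_tight_moments_norm_term_le`, from `(b|t|)ⁿ/n! ≤ e^{b|t|}`,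
   `Real.pow_div_factorial_le_exp`), and `|z|/b < 1`.

Mathlib (Bochner integral, dominated convergence for series, Tannery, the exponential series
`NormedSpace.expSeries_div_hasSum_exp`) + the tree's `WeilExplicit` / `WeilGroundState` API and
the landed stub files `stub_psiDecay`, `stub_mellinXi` (with `continuous_phi`, `norm_phi`) and
`stub_pointwise_of_weak` (only its helper `stub_pointwise_of_weak_integrable_weight`:
`‖c u‖ e^{b|t|}` is integrable for a ground state `u`); no named fact is used; no definitions.
Helper file (`--supports`), namespace `…Theorems.GroundStatesConvergeToXi`; all helpers are
prefixed `stub_pointwise_of_tight_moments_`.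
-/

set_option linter.dupNamespace false

noncomputable section

open MeasureTheory Complex Filter Set
open scoped Real Topology Nat

namespace Summit.RiemannHypothesis.RiemannHypothesis.Theorems.GroundStatesConvergeToXi

open Literature.NumberTheory.LFunctions

/-! ### The exponential series -/

/-- The real exponential series `e^y = Σ yⁿ/n!` (`NormedSpace.expSeries_div_hasSum_exp` and
`Real.exp_eq_exp_ℝ`). [folklore] -/
theorem stub_pointwise_of_tight_moments_hasSum_exp_real (y : ℝ) :
    HasSum (fun n : ℕ => y ^ n / n !) (Real.exp y) := by
  rw [Real.exp_eq_exp_ℝ]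
  exact NormedSpace.expSeries_div_hasSum_exp y

/-- The complex exponential series `e^w = Σ wⁿ/n!` (`NormedSpace.expSeries_div_hasSum_exp` and
`Complex.exp_eq_exp_ℂ`). [folklore] -/
theorem stub_pointwise_of_tight_moments_hasSum_cexp (w : ℂ) :
    HasSum (fun n : ℕ => w ^ n / n !) (cexp w) := by
  rw [Complex.exp_eq_exp_ℂ]
  exact NormedSpace.expSeries_div_hasSum_exp w

/-! ### Termwise estimates -/

/-- The modulus of the `n`-th term of the expanded Mellin integrand:
`‖zⁿ/n! · (w tⁿ)‖ = |z|ⁿ/n! · ‖w‖ |t|ⁿ`. [folklore] -/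
theorem stub_pointwise_of_tight_moments_norm_term (z w : ℂ) (n : ℕ) (t : ℝ) :
    ‖z ^ n / n ! * (w * (t : ℂ) ^ n)‖ = ‖z‖ ^ n / n ! * (‖w‖ * |t| ^ n) := by
  rw [norm_mul, norm_div, norm_pow, Complex.norm_natCast, norm_mul, norm_pow, Complex.norm_real,
    Real.norm_eq_abs]

/-- **Domination of the terms**: if `‖z‖ ≤ b` then `‖zⁿ/n! · (w tⁿ)‖ ≤ ‖w‖ (b|t|)ⁿ/n!`.
[folklore] -/
theorem stub_pointwise_of_tight_moments_norm_term_le_pow {z : ℂ} {b : ℝ} (hzb : ‖z‖ ≤ b)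
    (w : ℂ) (n : ℕ) (t : ℝ) :
    ‖z ^ n / n ! * (w * (t : ℂ) ^ n)‖ ≤ ‖w‖ * ((b * |t|) ^ n / n !) := by
  rw [stub_pointwise_of_tight_moments_norm_term]
  have h1 : ‖z‖ ^ n ≤ b ^ n := pow_le_pow_left₀ (norm_nonneg z) hzb n
  calc ‖z‖ ^ n / n ! * (‖w‖ * |t| ^ n) = ‖w‖ * (‖z‖ ^ n * |t| ^ n / n !) := by ring
    _ ≤ ‖w‖ * (b ^ n * |t| ^ n / n !) := by gcongr
    _ = ‖w‖ * ((b * |t|) ^ n / n !) := by rw [mul_pow]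

/-- **Geometric domination of the terms**: for `0 < b`,
`‖zⁿ/n! · (w tⁿ)‖ = (|z|/b)ⁿ ‖w‖ (b|t|)ⁿ/n! ≤ (|z|/b)ⁿ ‖w‖ e^{b|t|}`
(`Real.pow_div_factorial_le_exp`). [folklore] -/
theorem stub_pointwise_of_tight_moments_norm_term_le_geom {b : ℝ} (hb : 0 < b) (z w : ℂ)
    (n : ℕ) (t : ℝ) :
    ‖z ^ n / n ! * (w * (t : ℂ) ^ n)‖ ≤ (‖z‖ / b) ^ n * (‖w‖ * Real.exp (b * |t|)) := by
  rw [stub_pointwise_of_tight_moments_norm_term]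
  have h1 : (b * |t|) ^ n / n ! ≤ Real.exp (b * |t|) :=
    Real.pow_div_factorial_le_exp (b * |t|) (by positivity) n
  have hbn : b ^ n ≠ 0 := pow_ne_zero n hb.ne'
  calc ‖z‖ ^ n / n ! * (‖w‖ * |t| ^ n) = (‖z‖ / b) ^ n * (‖w‖ * ((b * |t|) ^ n / n !)) := by
        rw [div_pow, mul_pow]
        field_simp
    _ ≤ (‖z‖ / b) ^ n * (‖w‖ * Real.exp (b * |t|)) := by gcongr

/-- **The `k`-uniform majorant**: if `∫ ‖v‖ e^{b|t|} < ∞` with `0 < b`, then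
`‖zⁿ/n! ∫ v(t) tⁿ dt‖ ≤ (|z|/b)ⁿ ∫ ‖v(t)‖ e^{b|t|} dt` (no integrability of `v tⁿ` is needed:
a non-integrable integrand has integral `0`). [folklore] -/
theorem stub_pointwise_of_tight_moments_norm_term_le {v : ℝ → ℂ} {b : ℝ} (hb : 0 < b)
    (hI : Integrable fun t => ‖v t‖ * Real.exp (b * |t|)) (z : ℂ) (n : ℕ) :
    ‖z ^ n / n ! * ∫ t, v t * (t : ℂ) ^ n‖ ≤
      (‖z‖ / b) ^ n * ∫ t, ‖v t‖ * Real.exp (b * |t|) := by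
  rw [← integral_const_mul, ← integral_const_mul]
  exact norm_integral_le_of_norm_le (hI.const_mul _) (ae_of_all _ fun t =>
    stub_pointwise_of_tight_moments_norm_term_le_geom hb z (v t) n t)

/-! ### The exponential series inside the Mellin integral -/

/-- **Moment expansion of a Mellin–Laplace integral.** If `v` is (a.e. strongly) measurable with
`∫ ‖v(t)‖ e^{b|t|} dt < ∞` and `‖z‖ ≤ b`, then
`∫ v(t) e^{zt} dt = Σₙ zⁿ/n! ∫ v(t) tⁿ dt` as a convergent series: dominated convergence for
series (`hasSum_integral_of_dominated_convergence`) with the majorant `‖v(t)‖ (b|t|)ⁿ/n!`, which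
sums to the integrable `‖v(t)‖ e^{b|t|}`. [folklore] -/
theorem stub_pointwise_of_tight_moments_hasSum_integral {v : ℝ → ℂ} {b : ℝ} {z : ℂ}
    (hv : AEStronglyMeasurable v volume)
    (hI : Integrable fun t => ‖v t‖ * Real.exp (b * |t|)) (hzb : ‖z‖ ≤ b) :
    HasSum (fun n : ℕ => z ^ n / n ! * ∫ t, v t * (t : ℂ) ^ n) (∫ t, v t * cexp (z * t)) := by
  have key := hasSum_integral_of_dominated_convergence (μ := volume)
    (F := fun (n : ℕ) (t : ℝ) => z ^ n / n ! * (v t * (t : ℂ) ^ n))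
    (f := fun t : ℝ => v t * cexp (z * t))
    (fun n t => ‖v t‖ * ((b * |t|) ^ n / n !)) ?_ ?_ ?_ ?_ ?_
  · simpa only [integral_const_mul] using key
  · intro n
    exact (hv.mul (continuous_ofReal.pow n).aestronglyMeasurable).const_mul _
  · exact fun n => ae_of_all _ fun t =>
      stub_pointwise_of_tight_moments_norm_term_le_pow hzb (v t) n t
  · exact ae_of_all _ fun t => (Real.summable_pow_div_factorial (b * |t|)).mul_left _
  · refine hI.congr (ae_of_all _ fun t => ?_)
    simp only
    rw [tsum_mul_left, (stub_pointwise_of_tight_moments_hasSum_exp_real (b * |t|)).tsum_eq]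
  · refine ae_of_all _ fun t => ?_
    have h := (stub_pointwise_of_tight_moments_hasSum_cexp (z * t)).mul_left (v t)
    have e : (fun n : ℕ => z ^ n / n ! * (v t * (t : ℂ) ^ n)) =
        fun n : ℕ => v t * ((z * t) ^ n / n !) := funext fun n => by
      rw [mul_pow]
      ring
    rw [e]
    exact h

/-! ### Weighted integrability of ground states and of `Φ` -/

/-- For a ground state `u`, `‖u‖ e^{b|t|}` is integrable for every `b` (the window is compact
and `u` vanishes a.e. off it; `stub_pointwise_of_weak_integrable_weight` with `c = 1`).
[folklore] -/
theorem stub_pointwise_of_tight_moments_integrable_weight_one {a : ℝ} {u : ℝ → ℂ}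
    (hu : IsWeilGroundState a u) (b : ℝ) :
    Integrable fun t => ‖u t‖ * Real.exp (b * |t|) := by
  simpa only [one_mul] using stub_pointwise_of_weak_integrable_weight hu 1 b

/-- For Riemann's kernel `Φ(t) = 2Ψ(2t)`, `‖Φ‖ e^{b|t|}` is integrable for every `b` (all
exponential moments of `Ψ(2·)` are finite, `stub_psiDecay`). [folklore] -/
theorem stub_pointwise_of_tight_moments_integrable_phi_weight (b : ℝ) :
    Integrable fun t : ℝ => ‖(2 : ℂ) * LagariasMontague.Psic (2 * t)‖ * Real.exp (b * |t|) := by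
  refine (((stub_psiDecay.2 b).norm).const_mul 2).congr (ae_of_all _ fun t => ?_)
  simp only
  rw [norm_phi, Real.norm_eq_abs, abs_mul, abs_of_pos (Real.exp_pos _)]
  ring

/-! ### The stub -/

/-- **Stub `pointwise_of_tight_moments` (RH-free).** For ground states `u_k` and scalars `c_k`:
tightness (T) in every `L¹(e^{b|t|})`, `b < 1/2`, plus convergence (M) of all moments of
`c_k u_k` to the moments of `Φ = 2Ψ(2·)` give pointwise convergence `c_k û_k(σ) → ξ(σ)` at
every real `σ ∈ (0,1)`.  With `z = σ − 1/2`, `|z| < b := (|z| + 1/2)/2 < 1/2`: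
`c_k û_k(σ) = Σₙ zⁿ/n! · c_k ∫ u_k tⁿ` and `ξ(σ) = weilMellin Φ σ = Σₙ zⁿ/n! ∫ Φ tⁿ`
(`stub_pointwise_of_tight_moments_hasSum_integral`, `stub_mellinXi`, `stub_psiDecay`); termwise
convergence (M) with the `k`-uniform geometric majorant `M_b (|z|/b)ⁿ`
(`stub_pointwise_of_tight_moments_norm_term_le`) gives the limit by Tannery
(`tendsto_tsum_of_dominated_convergence`). [folklore] -/
theorem stub_pointwise_of_tight_moments
    {a : ℕ → ℝ} {u : ℕ → ℝ → ℂ} {c : ℕ → ℂ}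
    (hu : ∀ k, IsWeilGroundState (a k) (u k))
    (htight : ∀ b : ℝ, b < 1 / 2 → ∃ M : ℝ, ∀ k, ∫ t, ‖c k * u k t‖ * Real.exp (b * |t|) ≤ M)
    (hmom : ∀ n : ℕ, Tendsto (fun k => c k * ∫ t, u k t * (t : ℂ) ^ n) atTop
      (𝓝 (∫ t, 2 * LagariasMontague.Psic (2 * t) * (t : ℂ) ^ n))) :
    ∀ σ : ℝ, σ ∈ Ioo (0 : ℝ) 1 →
      Tendsto (fun k => c k * weilMellin (u k) σ) atTop (𝓝 (riemannXi σ)) := by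
  intro σ hσ
  obtain ⟨hσ0, hσ1⟩ := hσ
  -- exponents: `z = σ - 1/2`, `|z| < b < 1/2`
  set z : ℂ := (σ : ℂ) - 1 / 2 with hz
  have hnz : ‖z‖ = |σ - 1 / 2| := by
    have e : (σ : ℂ) - 1 / 2 = ((σ - 1 / 2 : ℝ) : ℂ) := by push_cast; ring
    rw [hz, e, Complex.norm_real, Real.norm_eq_abs]
  have hzlt : ‖z‖ < 1 / 2 := by rw [hnz, abs_lt]; constructor <;> linarith
  set b : ℝ := (‖z‖ + 1 / 2) / 2 with hb
  have hzb : ‖z‖ < b := by rw [hb]; linarith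
  have hb2 : b < 1 / 2 := by rw [hb]; linarith
  have hb0 : 0 < b := (norm_nonneg z).trans_lt hzb
  obtain ⟨M, hM⟩ := htight b hb2
  have hq0 : 0 ≤ ‖z‖ / b := div_nonneg (norm_nonneg z) hb0.le
  have hq1 : ‖z‖ / b < 1 := (div_lt_one hb0).2 hzb
  -- (1) the moment expansion of `c_k û_k(σ)`
  have hA : ∀ k, HasSum (fun n : ℕ => z ^ n / n ! * (c k * ∫ t, u k t * (t : ℂ) ^ n))
      (c k * weilMellin (u k) σ) := fun k => by
    have h := (stub_pointwise_of_tight_moments_hasSum_integral (hu k).memLp.1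
      (stub_pointwise_of_tight_moments_integrable_weight_one (hu k) b) hzb.le).mul_left (c k)
    have e : (fun n : ℕ => z ^ n / n ! * (c k * ∫ t, u k t * (t : ℂ) ^ n)) =
        fun n : ℕ => c k * (z ^ n / n ! * ∫ t, u k t * (t : ℂ) ^ n) := funext fun n => by ring
    rw [e]
    exact h
  -- (1') the moment expansion of `ξ(σ) = weilMellin Φ σ`
  have hB : HasSum (fun n : ℕ => z ^ n / n ! * ∫ t, 2 * LagariasMontague.Psic (2 * t) * (t : ℂ) ^ n)
      (riemannXi σ) := by
    rw [← stub_mellinXi stub_psiDecay.1 stub_psiDecay.2 σ]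
    simp only [weilMellin]
    exact stub_pointwise_of_tight_moments_hasSum_integral continuous_phi.aestronglyMeasurable
      (stub_pointwise_of_tight_moments_integrable_phi_weight b) hzb.le
  -- (2) Tannery in `k`, geometric majorant `M (|z|/b)ⁿ`
  have hT : Tendsto (fun k => ∑' n : ℕ, z ^ n / n ! * (c k * ∫ t, u k t * (t : ℂ) ^ n)) atTop
      (𝓝 (∑' n : ℕ, z ^ n / n ! * ∫ t, 2 * LagariasMontague.Psic (2 * t) * (t : ℂ) ^ n)) :=
    tendsto_tsum_of_dominated_convergence
      (f := fun k (n : ℕ) => z ^ n / n ! * (c k * ∫ t, u k t * (t : ℂ) ^ n))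
      (g := fun n : ℕ => z ^ n / n ! * ∫ t, 2 * LagariasMontague.Psic (2 * t) * (t : ℂ) ^ n)
      (bound := fun n => M * (‖z‖ / b) ^ n)
      ((summable_geometric_of_lt_one hq0 hq1).mul_left M) (fun n => (hmom n).const_mul _)
      (Eventually.of_forall fun k n => by
        have h1 : c k * ∫ t, u k t * (t : ℂ) ^ n = ∫ t, c k * u k t * (t : ℂ) ^ n := by
          rw [← integral_const_mul]
          simp_rw [mul_assoc]
        rw [h1]
        calc ‖z ^ n / n ! * ∫ t, c k * u k t * (t : ℂ) ^ n‖
            ≤ (‖z‖ / b) ^ n * ∫ t, ‖c k * u k t‖ * Real.exp (b * |t|) :=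
              stub_pointwise_of_tight_moments_norm_term_le hb0
                (stub_pointwise_of_weak_integrable_weight (hu k) (c k) b) z n
          _ ≤ (‖z‖ / b) ^ n * M := mul_le_mul_of_nonneg_left (hM k) (pow_nonneg hq0 n)
          _ = M * (‖z‖ / b) ^ n := mul_comm _ _)
  rw [hB.tsum_eq] at hT
  exact hT.congr fun k => (hA k).tsum_eq

end Summit.RiemannHypothesis.RiemannHypothesis.Theorems.GroundStatesConvergeToXi

end
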